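import Mathlib.Combinatorics.Pigeonhole
import Summits.CriticalPhenomena.SAWScalingLimit.Theorems.SAWLeftRightFKGFKGToTraversalBoundSlitNecklacePieces
import HarnessLib

/-!
# Necklace assembly (far-tip form), part 2: sub-shell pigeonhole for strictly separated index windows

Crux `SAWLeftRightFKG.FKGToTraversalBound` (stmt-CriticalPhenomena-1878), line `slit-necklace`
(reshape r4), stub `stub_necklaceAssemblyFar`, steps A3/A4 of the chart
`Cruxes/FKGToTraversalBound/Lines/slit-necklace-chart-r4.md` §3: the WALK-LEVEL analogue of the curve
lemma `hasTraversals_subshell_pigeonhole` (p129366), in the index-window currency `HasSepWindows` of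
`…SlitNecklacePieces` (p129943).

Deterministic geometry of walks.  Let `p` be a walk of any graph whose consecutive vertices are embedded
(`emb`) within `ε₀` of each other, `D(x; ρ, R)` a shell with `0 ≤ ρ`, `R - ρ ≥ 5 s + 2 ε₀`, `s > 0`, and
`c₀, …, c_{N-1}` centres such that every point of the closed `R`-ball about `x` is within `s / 2` of some
`cᵢ`.  If `p` has `N k` strictly separated index windows inside `[lo, hi]` across `D(x; ρ, R)`, `k > 0`,
then for some centre `cᵢ` at distance within `ε₀ + s / 2` of the mid-radius `(ρ + R) / 2` from `x` the
walk has `k` strictly separated index windows inside `[lo, hi]` across the modulus-`2` shell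
`D(cᵢ; s, 2 s)` (each a sub-window of one of the given windows).

* One window (`subshellPigeonhole_refineWindow`): cut the window at the FIRST index whose vertex is past
  mid-radius (at distance `≥ (ρ + R)/2` from `x` for an outward window, `≤ (ρ + R)/2` for an inward one);
  by the step bound that vertex is within `ε₀` of the mid-sphere, hence inside the closed `R`-ball and
  within `s / 2` of some centre `cᵢ`, while the end of the window outside the open `R`-ball is at distance
  `≥ (R - ρ)/2 - ε₀ - s/2 ≥ 2 s` from `cᵢ`.
* Pigeonhole on the centres (`Fintype.exists_le_card_fiber_of_mul_le_card`), increasing enumeration of a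
  fibre (`Finset.orderEmbOfFin`); separation and the range `[lo, hi]` are inherited.

Only theorems; axioms are the standard three.
-/

noncomputable section

open Set Metric

namespace Summit.CriticalPhenomena.SAWScalingLimit.Theorems.FKGToTraversalBound.SlitNecklace

section

variable {V E : Type*} [PseudoMetricSpace E] {G : SimpleGraph V} {u v : V}

/-- **One window.**  An index window `[a, b]` of `p` across `D(x; ρ, R)` (`R - ρ ≥ 5 s + 2 ε₀`, `s > 0`,
steps `≤ ε₀`) contains a sub-window `[a', b']` across the modulus-`2` shell `D(cᵢ; s, 2 s)` about a centre
`cᵢ` of any `s / 2`-net of the closed `R`-ball about `x`, with `dist cᵢ x` within `ε₀ + s / 2` of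
`(ρ + R) / 2`: cut at the first index past mid-radius and keep the part ending outside the open `R`-ball.
[folklore] -/
private theorem subshellPigeonhole_refineWindow (emb : V → E) (p : G.Walk u v) {ε₀ : ℝ} (x : E)
    {ρ R s : ℝ} {N : ℕ} (c : Fin N → E)
    (hstep : ∀ n, dist (emb (p.getVert n)) (emb (p.getVert (n + 1))) ≤ ε₀)
    (hs : 0 < s) (hsR : 5 * s + 2 * ε₀ ≤ R - ρ)
    (hcov : ∀ m : E, dist m x ≤ R → ∃ i : Fin N, dist m (c i) ≤ s / 2) {a b : ℕ} (hab : a ≤ b)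
    (hside : (dist (emb (p.getVert a)) x ≤ ρ ∧ R ≤ dist (emb (p.getVert b)) x) ∨
      (R ≤ dist (emb (p.getVert a)) x ∧ dist (emb (p.getVert b)) x ≤ ρ)) :
    ∃ (i : Fin N) (a' b' : ℕ), a ≤ a' ∧ a' ≤ b' ∧ b' ≤ b ∧
      (ρ + R) / 2 - ε₀ - s / 2 ≤ dist (c i) x ∧ dist (c i) x ≤ (ρ + R) / 2 + ε₀ + s / 2 ∧
      ((dist (emb (p.getVert a')) (c i) ≤ s ∧ 2 * s ≤ dist (emb (p.getVert b')) (c i)) ∨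
        (2 * s ≤ dist (emb (p.getVert a')) (c i) ∧ dist (emb (p.getVert b')) (c i) ≤ s)) := by
  classical
  set d : ℕ → ℝ := fun n => dist (emb (p.getVert n)) x with hd
  have hε₀ : 0 ≤ ε₀ := le_trans dist_nonneg (hstep 0)
  -- the step bound, in both directions, at an index `θ ≥ 1`
  have hup : ∀ θ, 0 < θ → d θ ≤ d (θ - 1) + ε₀ := fun θ hθ => by
    have h1 := hstep (θ - 1)
    rw [Nat.sub_add_cancel hθ] at h1
    have h2 := dist_triangle (emb (p.getVert θ)) (emb (p.getVert (θ - 1))) x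
    rw [dist_comm] at h1
    simp only [hd]
    linarith
  have hdown : ∀ θ, 0 < θ → d (θ - 1) - ε₀ ≤ d θ := fun θ hθ => by
    have h1 := hstep (θ - 1)
    rw [Nat.sub_add_cancel hθ] at h1
    have h2 := dist_triangle (emb (p.getVert (θ - 1))) (emb (p.getVert θ)) x
    simp only [hd]
    linarith
  rcases hside with ⟨ha, hb⟩ | ⟨ha, hb⟩
  · -- outward window: first index `θ ≥ a` at distance `≥ (ρ + R) / 2`
    have hex : ∃ n, a ≤ n ∧ (ρ + R) / 2 ≤ d n := ⟨b, hab, by simp only [hd]; linarith⟩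
    set θ := Nat.find hex with hθ
    have hθspec : a ≤ θ ∧ (ρ + R) / 2 ≤ d θ := Nat.find_spec hex
    have hθb : θ ≤ b := Nat.find_min' hex ⟨hab, by simp only [hd]; linarith⟩
    have hθa : a < θ := by
      rcases hθspec.1.lt_or_eq with h | h
      · exact h
      · exfalso
        have h2 := hθspec.2
        rw [← h] at h2
        simp only [hd] at h2
        linarith
    have hprev : d (θ - 1) < (ρ + R) / 2 := by
      by_contra hle
      have hmin := Nat.find_min hex (show θ - 1 < θ by omega)
      exact hmin ⟨by omega, not_lt.1 hle⟩
    have hdθ : d θ < (ρ + R) / 2 + ε₀ := by linarith [hup θ (by omega)]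
    obtain ⟨i, hi⟩ := hcov (emb (p.getVert θ)) (by simp only [hd] at hdθ; linarith)
    have ht1 := dist_triangle (c i) (emb (p.getVert θ)) x
    have ht2 := dist_triangle (emb (p.getVert θ)) (c i) x
    have ht3 := dist_triangle (emb (p.getVert b)) (c i) x
    rw [dist_comm (c i) (emb (p.getVert θ))] at ht1
    have hdθ' : (ρ + R) / 2 ≤ d θ := hθspec.2
    simp only [hd] at hdθ hdθ'
    refine ⟨i, θ, b, hθa.le, hθb, le_rfl, by linarith, by linarith, Or.inl ⟨by linarith, by linarith⟩⟩
  · -- inward window: first index `θ ≥ a` at distance `≤ (ρ + R) / 2`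
    have hex : ∃ n, a ≤ n ∧ d n ≤ (ρ + R) / 2 := ⟨b, hab, by simp only [hd]; linarith⟩
    set θ := Nat.find hex with hθ
    have hθspec : a ≤ θ ∧ d θ ≤ (ρ + R) / 2 := Nat.find_spec hex
    have hθb : θ ≤ b := Nat.find_min' hex ⟨hab, by simp only [hd]; linarith⟩
    have hθa : a < θ := by
      rcases hθspec.1.lt_or_eq with h | h
      · exact h
      · exfalso
        have h2 := hθspec.2
        rw [← h] at h2
        simp only [hd] at h2
        linarith
    have hprev : (ρ + R) / 2 < d (θ - 1) := by
      by_contra hle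
      have hmin := Nat.find_min hex (show θ - 1 < θ by omega)
      exact hmin ⟨by omega, not_lt.1 hle⟩
    have hdθ : (ρ + R) / 2 - ε₀ < d θ := by linarith [hdown θ (by omega)]
    have hdθ' : d θ ≤ (ρ + R) / 2 := hθspec.2
    obtain ⟨i, hi⟩ := hcov (emb (p.getVert θ)) (by simp only [hd] at hdθ'; linarith)
    have ht1 := dist_triangle (c i) (emb (p.getVert θ)) x
    have ht2 := dist_triangle (emb (p.getVert θ)) (c i) x
    have ht3 := dist_triangle (emb (p.getVert a)) (c i) x
    rw [dist_comm (c i) (emb (p.getVert θ))] at ht1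
    simp only [hd] at hdθ hdθ'
    refine ⟨i, a, θ, le_rfl, hθa.le, hθb, by linarith, by linarith, Or.inr ⟨by linarith, by linarith⟩⟩

end

/-- **Registered part of `stub_necklaceAssemblyFar`: sub-shell pigeonhole for strictly separated index
windows** (walk-level form of `hasTraversals_subshell_pigeonhole`).  Let the consecutive vertices of the walk
`p` be embedded within `ε₀` of each other, let every point of the closed `R`-ball about `x` be within `s / 2`
of one of the `N` centres `cᵢ`, `0 ≤ ρ`, `0 < s`, `5 s + 2 ε₀ ≤ R - ρ`, `0 < k`.  If `p` has `N k` strictly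
separated index windows inside `[lo, hi]` across `D(x; ρ, R)`, then some centre `cᵢ` with
`|dist cᵢ x - (ρ + R)/2| ≤ ε₀ + s/2` is the centre of a modulus-`2` shell `D(cᵢ; s, 2 s)` across which `p` has
`k` strictly separated index windows inside `[lo, hi]` (cut each window at the first index past mid-radius,
assign a centre within `s / 2` of the cut vertex, pigeonhole on the centres). [folklore] -/
theorem hasSepWindows_subshell_pigeonhole : ∀ {V E : Type*} [PseudoMetricSpace E] {G : SimpleGraph V}
    {u v : V} (emb : V → E) (p : G.Walk u v) (ε₀ : ℝ) (x : E) (ρ R s : ℝ) {N : ℕ} (k lo hi : ℕ)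
    (c : Fin N → E), (∀ n, dist (emb (p.getVert n)) (emb (p.getVert (n + 1))) ≤ ε₀) →
    0 ≤ ρ → 0 < s → 5 * s + 2 * ε₀ ≤ R - ρ → 0 < k →
    (∀ m : E, dist m x ≤ R → ∃ i : Fin N, dist m (c i) ≤ s / 2) →
    HasSepWindows emb p (N * k) lo hi x ρ R →
    ∃ i : Fin N, (ρ + R) / 2 - ε₀ - s / 2 ≤ dist (c i) x ∧ dist (c i) x ≤ (ρ + R) / 2 + ε₀ + s / 2 ∧
      HasSepWindows emb p k lo hi (c i) s (2 * s) := by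
  intro V E _ G u v emb p ε₀ x ρ R s N k lo hi c hstep hρ hs hsR hk hcov hwin
  classical
  have hε₀ : 0 ≤ ε₀ := le_trans dist_nonneg (hstep 0)
  -- `N ≠ 0`: the centre `x` of the ball is covered
  obtain ⟨i₀, -⟩ := hcov x (by rw [dist_self]; linarith)
  haveI : Nonempty (Fin N) := ⟨i₀⟩
  obtain ⟨a, b, hab, hside, hsep⟩ := hwin
  -- refine every window to a window across a modulus-`2` sub-shell about some centre `c (idx m)`
  choose idx a' b' ha' ha'b' hb' hloc₁ hloc₂ hside' using fun m =>
    subshellPigeonhole_refineWindow emb p x c hstep hs hsR hcov (hab m).2.1 (hside m)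
  -- pigeonhole on the centres
  obtain ⟨y, hy⟩ := Fintype.exists_le_card_fiber_of_mul_le_card (f := idx) (n := k)
    (by simp only [Fintype.card_fin, le_refl])
  obtain ⟨F, hF, hcard⟩ := Finset.exists_subset_card_eq hy
  have hidx : ∀ j : Fin k, idx (F.orderEmbOfFin hcard j) = y := fun j => by
    simpa using hF (F.orderEmbOfFin_mem hcard j)
  have j₀ : Fin k := ⟨0, hk⟩
  refine ⟨y, ?_, ?_, fun j => a' (F.orderEmbOfFin hcard j), fun j => b' (F.orderEmbOfFin hcard j),
    fun j => ?_, fun j => ?_, fun j j' hjj' => ?_⟩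
  · have := hloc₁ (F.orderEmbOfFin hcard j₀)
    rwa [hidx j₀] at this
  · have := hloc₂ (F.orderEmbOfFin hcard j₀)
    rwa [hidx j₀] at this
  · have h1 := hab (F.orderEmbOfFin hcard j)
    have h2 := ha' (F.orderEmbOfFin hcard j)
    have h3 := ha'b' (F.orderEmbOfFin hcard j)
    have h4 := hb' (F.orderEmbOfFin hcard j)
    exact ⟨h1.1.trans h2, h3, h4.trans h1.2.2⟩
  · have := hside' (F.orderEmbOfFin hcard j)
    rwa [hidx j] at this
  · calc b' (F.orderEmbOfFin hcard j) ≤ b (F.orderEmbOfFin hcard j) := hb' _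
      _ < a (F.orderEmbOfFin hcard j') := hsep ((F.orderEmbOfFin hcard).strictMono hjj')
      _ ≤ a' (F.orderEmbOfFin hcard j') := ha' _

end Summit.CriticalPhenomena.SAWScalingLimit.Theorems.FKGToTraversalBound.SlitNecklace

end
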